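import Summits.HodgeConjecture.HodgeConjecture.Theorems.F0P3cStCharTSUpTrWIFHClosed         -- ★ p852476 (H5″) (this seat): compact sockets paid, `hJacNC` left
import Summits.HodgeConjecture.HodgeConjecture.Theorems.F0P3cStCharTSUpTrJacCartanSplitH     -- ★ p852461 (H4s)∕(B8) (LH7-p02 (g8)): `tubeJacobianLocal_splitCartanH_of_dock` (the split-Cartan socket on `H_v`, modulo the `U(Φ₂)` dock)
import Summits.HodgeConjecture.HodgeConjecture.Theorems.F0P3cStCharTSUpTrJacSplitModelTwo    -- ★ (B8-D) FILE A (LH6-p04 (g7)): `tubeJacobianLocal_splitCartan_U2` — the `U(Φ₂)` split-torus model dock (closes (H4s))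
import Summits.HodgeConjecture.HodgeConjecture.Theorems.F0P3cStCharTSCartanAllH             -- ★ (H1) F-D (F0P3a-p03 (g26)): `exists_cartanAllH_weylShape` (the CARTAN-ALL-H family with `M_H ∈`, the `Z_H(γ₀)` shape, «`≠ M_H` ⇒ compact», cover, irredundancy)
import HarnessLib

/-!
# F0 · P3c · ROAD «UP-TR» brick (H5‴) «WIF-H, ALL SOCKETS ROUTED»: the Weyl integration formula on `H_v = U(Φ₂)(L⁺_v) × U(Φ₁)(L⁺_v)` over the CARTAN-ALL-H family, compact tube
# Jacobians ★ (H4c), the split one ★ (H4s) ∘ ★ (B8-D) — NO tube-Jacobian hypothesis left (Rogawski 1990 §12.5 pp. 182–183; Harish-Chandra 1970 L. 22, 42)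

Cell `pub/hodgecm-mathlib`, crux H413 = `stmt-HodgeConjecture-24833` (lane `--supports`, helper); seat F0P3a-p05 (g24); ROAD «UP-TR» (LEAD T14-21, holder ∕ dealer F0P3-p02 (g23)),
sequel of ★ (H5) p852393 ∕ (H5′) p852434 ∕ (H5″) p852476.  THEOREMS ONLY; sorry-free; no definition ∕ instance ∕ notation ∕ named fact; ★-only imports; axioms TRIO.

THE POINT.  ★ (H5″) leaves one socket on `H_v`: `hJacNC`, the local tube Jacobian at the NON-COMPACT Cartan representatives.  By ★ (H1) `exists_cartanAllH_weylShape` the only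
non-compact member of the CARTAN-ALL-H family is the split Cartan `M_H = M₂ × U(Φ₁)` (`hcpt : T ≠ M_H → IsCompact T`), and ★ (H4s)∕(B8) `tubeJacobianLocal_splitCartanH_of_dock`
(LH7-p02's «JAC-LOC₂» terminus) supplies the socket there from the rank-2 van Dijk computation on `U(Φ₂)(L⁺_v)` docked at its `U(Φ₂)` model by ★ (B8-D) `tubeJacobianLocal_splitCartan_U2` (LH6-p04, over ★ (B7b) LH4-p01's split-torus model and the JAC-LOC₂ box∕sandwich∕norm chain).  So here:
`hJacNC` DISCHARGED (`hJacNC_of_splitDock`, through ★ `image_conjFamily_prod_eq` and the `eDH` weight computation) from (H1)'s `hcpt` — whence the four currencies of ★ (H5″)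
hold with NO tube-Jacobian hypothesis AT ALL by the one-line compositions listed in §2 (not re-declared: dedup rule): what remains is the CARTAN-ALL-H family's four clauses (★ (H1)
`exists_cartanAllH_weylShape`), the canonical-measure pin `hcanH`, the per-representative Haar data `tT ∕ htT` (★ (H3d)), conjugation charts `Φ ∕ hΦ` (★ `exists_conjFamily`) and the
`D_H` pin `hdh`.  HONEST LABEL: count-neutral (block consequents 11 → 10 → 9 only at the rider editions; organs 2 = 2; h413 registry
untouched); HC_CM is proved only modulo the 7 printed citations (2 remaining named inputs: hLiu418 = `stmt-HodgeConjecture-24832`, h413 = `stmt-HodgeConjecture-24833`) until rung 0 closes.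

## References
* [Rogawski1990] J. D. Rogawski, *Automorphic Representations of Unitary Groups in Three Variables*, Ann. of Math. Stud. 123 (1990), §12.5 pp. 182–183 (Weyl integration formula on `H`,
  Lemma 12.5.1), §3.6 pp. 28–31, §4.9 p. 54.
* [HarishChandra1970] Harish-Chandra (notes by G. van Dijk), *Harmonic analysis on reductive p-adic groups*, LNM 162 (1970), Lemma 22, Lemma 42.
* [vanDijk1972] G. van Dijk, *Computation of certain induced characters of p-adic groups*, Math. Ann. 199 (1972), §2.
-/

set_option autoImplicit false
-- the mandated namespace has the single-problem summit's repeated segment (`HodgeConjecture.HodgeConjecture`)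
set_option linter.dupNamespace false

noncomputable section

open MeasureTheory Measure Set Filter Topology Function NumberField IsDedekindDomain Matrix Polynomial
open Literature.MeasureTheory.Group
open Literature.NumberTheory.Automorphic Literature.NumberTheory.Automorphic.UnitaryGroup Literature.NumberTheory.Rogawski1990
open Literature.NumberTheory.GaloisRepresentations
open Summit.HodgeConjecture.HodgeConjecture.Cruxes.H413
open Summit.HodgeConjecture.HodgeConjecture.Cruxes.H413.F0P3cStCharTSUpTrWIFH
open Summit.HodgeConjecture.HodgeConjecture.Cruxes.H413.F0P3cStCharTSUpTrWIFHInst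
open Summit.HodgeConjecture.HodgeConjecture.Cruxes.H413.F0P3cStCharTSUpTrWIFHClosed
open scoped ENNReal NNReal MatrixGroups Pointwise

namespace Summit.HodgeConjecture.HodgeConjecture.Cruxes.H413.F0P3cStCharTSUpTrWIFHFull

variable {L : Type} [Field L] [NumberField L] [IsCMField L] {v : HeightOneSpectrum (𝓞 ↥(maximalRealSubfield L))}

section Family

variable (hns : ∀ w : PlacesOver L v, IsCMField.complexConj L • w.1 = w.1)
  [MeasurableSpace ((UnitaryGroup.cmDatum L 2 (Matrix.of fun i j : Fin 2 => if i.val + j.val + 1 = 2 then (1 : L) else 0)).Local v × (UnitaryGroup.cmDatum L 1 (Matrix.of fun i j : Fin 1 => if i.val + j.val + 1 = 1 then (1 : L) else 0)).Local v)] [BorelSpace ((UnitaryGroup.cmDatum L 2 (Matrix.of fun i j : Fin 2 => if i.val + j.val + 1 = 2 then (1 : L) else 0)).Local v × (UnitaryGroup.cmDatum L 1 (Matrix.of fun i j : Fin 1 => if i.val + j.val + 1 = 1 then (1 : L) else 0)).Local v)]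
  (νHv : Measure ((UnitaryGroup.cmDatum L 2 (Matrix.of fun i j : Fin 2 => if i.val + j.val + 1 = 2 then (1 : L) else 0)).Local v × (UnitaryGroup.cmDatum L 1 (Matrix.of fun i j : Fin 1 => if i.val + j.val + 1 = 1 then (1 : L) else 0)).Local v)) [νHv.IsHaarMeasure] [νHv.IsMulRightInvariant]
  (SHall : Finset (Subgroup ((UnitaryGroup.cmDatum L 2 (Matrix.of fun i j : Fin 2 => if i.val + j.val + 1 = 2 then (1 : L) else 0)).Local v × (UnitaryGroup.cmDatum L 1 (Matrix.of fun i j : Fin 1 => if i.val + j.val + 1 = 1 then (1 : L) else 0)).Local v)))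
  (hS : ∀ T ∈ SHall, ∃ γ₀ : ((UnitaryGroup.cmDatum L 2 (Matrix.of fun i j : Fin 2 => if i.val + j.val + 1 = 2 then (1 : L) else 0)).Local v × (UnitaryGroup.cmDatum L 1 (Matrix.of fun i j : Fin 1 => if i.val + j.val + 1 = 1 then (1 : L) else 0)).Local v), IsLocalGRegular L v γ₀ ∧ T = Subgroup.centralizer ({γ₀} : Set ((UnitaryGroup.cmDatum L 2 (Matrix.of fun i j : Fin 2 => if i.val + j.val + 1 = 2 then (1 : L) else 0)).Local v × (UnitaryGroup.cmDatum L 1 (Matrix.of fun i j : Fin 1 => if i.val + j.val + 1 = 1 then (1 : L) else 0)).Local v)))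
  (hcpt : ∀ T ∈ SHall, T ≠ ((cmBorelTriple L 2 v).M).prod ⊤ → IsCompact (T : Set ((UnitaryGroup.cmDatum L 2 (Matrix.of fun i j : Fin 2 => if i.val + j.val + 1 = 2 then (1 : L) else 0)).Local v × (UnitaryGroup.cmDatum L 1 (Matrix.of fun i j : Fin 1 => if i.val + j.val + 1 = 1 then (1 : L) else 0)).Local v)))
  (Φ : ∀ T : ↥SHall, (((UnitaryGroup.cmDatum L 2 (Matrix.of fun i j : Fin 2 => if i.val + j.val + 1 = 2 then (1 : L) else 0)).Local v × (UnitaryGroup.cmDatum L 1 (Matrix.of fun i j : Fin 1 => if i.val + j.val + 1 = 1 then (1 : L) else 0)).Local v) ⧸ (T : Subgroup ((UnitaryGroup.cmDatum L 2 (Matrix.of fun i j : Fin 2 => if i.val + j.val + 1 = 2 then (1 : L) else 0)).Local v × (UnitaryGroup.cmDatum L 1 (Matrix.of fun i j : Fin 1 => if i.val + j.val + 1 = 1 then (1 : L) else 0)).Local v))) × ↥(T : Subgroup ((UnitaryGroup.cmDatum L 2 (Matrix.of fun i j : Fin 2 => if i.val + j.val + 1 = 2 then (1 : L) else 0)).Local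 v × (UnitaryGroup.cmDatum L 1 (Matrix.of fun i j : Fin 1 => if i.val + j.val + 1 = 1 then (1 : L) else 0)).Local v)) → ((UnitaryGroup.cmDatum L 2 (Matrix.of fun i j : Fin 2 => if i.val + j.val + 1 = 2 then (1 : L) else 0)).Local v × (UnitaryGroup.cmDatum L 1 (Matrix.of fun i j : Fin 1 => if i.val + j.val + 1 = 1 then (1 : L) else 0)).Local v))
  (hΦ : ∀ (T : ↥SHall) (x : ((UnitaryGroup.cmDatum L 2 (Matrix.of fun i j : Fin 2 => if i.val + j.val + 1 = 2 then (1 : L) else 0)).Local v × (UnitaryGroup.cmDatum L 1 (Matrix.of fun i j : Fin 1 => if i.val + j.val + 1 = 1 then (1 : L) else 0)).Local v)) (t : ↥(T : Subgroup ((UnitaryGroup.cmDatum L 2 (Matrix.of fun i j : Fin 2 => if i.val + j.val + 1 = 2 then (1 : L) else 0)).Local v × (UnitaryGroup.cmDatum L 1 (Matrix.of fun i j : Fin 1 => if i.val + j.val + 1 = 1 then (1 : L) else 0)).Local v))), Φ T (QuotientGroup.mk x, t) = x * t * x⁻¹)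
  (tT : ∀ T : ↥SHall, Measure ↥(T : Subgroup ((UnitaryGroup.cmDatum L 2 (Matrix.of fun i j : Fin 2 => if i.val + j.val + 1 = 2 then (1 : L) else 0)).Local v × (UnitaryGroup.cmDatum L 1 (Matrix.of fun i j : Fin 1 => if i.val + j.val + 1 = 1 then (1 : L) else 0)).Local v))) [∀ T, (tT T).IsHaarMeasure] [∀ T, (tT T).IsInvInvariant]
  (htT : ∀ T : ↥SHall, tT T (compactCore ↥(T : Subgroup ((UnitaryGroup.cmDatum L 2 (Matrix.of fun i j : Fin 2 => if i.val + j.val + 1 = 2 then (1 : L) else 0)).Local v × (UnitaryGroup.cmDatum L 1 (Matrix.of fun i j : Fin 1 => if i.val + j.val + 1 = 1 then (1 : L) else 0)).Local v))) = 1)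

/-! ## §1 The non-compact socket, routed to ★ (H4s) -/

set_option maxHeartbeats 1600000 in
set_option synthInstance.maxHeartbeats 400000 in
-- long socket statements on the CM product carrier (class of ★ (H4c)∕(H4s) termini)
include hns hcpt hΦ htT in
/-- **The `hJacNC` socket of ★ (H5″) HOLDS**: a non-compact member of the family IS the split Cartan `M_H` (`hcpt`), where ★ (H4s) `tubeJacobianLocal_splitCartanH_of_dock` gives the
local tube Jacobian with weight `D_H²` (its `Φ`-image form turned into the Φ-free letter by ★ `image_conjFamily_prod_eq`; its weight pin `(D t : ℝ) = (√√radicand₂)²` by `NNReal.sq_sqrt`).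
[cite: HarishChandra1970, Lemma 22] [cite: vanDijk1972, §2] [cite: Rogawski1990, §12.5 pp. 182–183] -/
theorem hJacNC_of_splitDock : ∀ T : ↥SHall, ¬ IsCompact ((T : Subgroup ((UnitaryGroup.cmDatum L 2 (Matrix.of fun i j : Fin 2 => if i.val + j.val + 1 = 2 then (1 : L) else 0)).Local v × (UnitaryGroup.cmDatum L 1 (Matrix.of fun i j : Fin 1 => if i.val + j.val + 1 = 1 then (1 : L) else 0)).Local v)) : Set ((UnitaryGroup.cmDatum L 2 (Matrix.of fun i j : Fin 2 => if i.val + j.val + 1 = 2 then (1 : L) else 0)).Local v × (UnitaryGroup.cmDatum L 1 (Matrix.of fun i j : Fin 1 => if i.val + j.val + 1 = 1 then (1 : L) else 0)).Local v)) →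
      letI : MeasurableSpace (((UnitaryGroup.cmDatum L 2 (Matrix.of fun i j : Fin 2 => if i.val + j.val + 1 = 2 then (1 : L) else 0)).Local v × (UnitaryGroup.cmDatum L 1 (Matrix.of fun i j : Fin 1 => if i.val + j.val + 1 = 1 then (1 : L) else 0)).Local v) ⧸ (T : Subgroup ((UnitaryGroup.cmDatum L 2 (Matrix.of fun i j : Fin 2 => if i.val + j.val + 1 = 2 then (1 : L) else 0)).Local v × (UnitaryGroup.cmDatum L 1 (Matrix.of fun i j : Fin 1 => if i.val + j.val + 1 = 1 then (1 : L) else 0)).Local v))) := borel _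
      haveI : BorelSpace (((UnitaryGroup.cmDatum L 2 (Matrix.of fun i j : Fin 2 => if i.val + j.val + 1 = 2 then (1 : L) else 0)).Local v × (UnitaryGroup.cmDatum L 1 (Matrix.of fun i j : Fin 1 => if i.val + j.val + 1 = 1 then (1 : L) else 0)).Local v) ⧸ (T : Subgroup ((UnitaryGroup.cmDatum L 2 (Matrix.of fun i j : Fin 2 => if i.val + j.val + 1 = 2 then (1 : L) else 0)).Local v × (UnitaryGroup.cmDatum L 1 (Matrix.of fun i j : Fin 1 => if i.val + j.val + 1 = 1 then (1 : L) else 0)).Local v))) := ⟨rfl⟩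
      ∀ t₀ : ↥(T : Subgroup ((UnitaryGroup.cmDatum L 2 (Matrix.of fun i j : Fin 2 => if i.val + j.val + 1 = 2 then (1 : L) else 0)).Local v × (UnitaryGroup.cmDatum L 1 (Matrix.of fun i j : Fin 1 => if i.val + j.val + 1 = 1 then (1 : L) else 0)).Local v)), IsLocalGRegular L v (t₀ : ((UnitaryGroup.cmDatum L 2 (Matrix.of fun i j : Fin 2 => if i.val + j.val + 1 = 2 then (1 : L) else 0)).Local v × (UnitaryGroup.cmDatum L 1 (Matrix.of fun i j : Fin 1 => if i.val + j.val + 1 = 1 then (1 : L) else 0)).Local v)) →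
        ∃ U : Set ↥(T : Subgroup ((UnitaryGroup.cmDatum L 2 (Matrix.of fun i j : Fin 2 => if i.val + j.val + 1 = 2 then (1 : L) else 0)).Local v × (UnitaryGroup.cmDatum L 1 (Matrix.of fun i j : Fin 1 => if i.val + j.val + 1 = 1 then (1 : L) else 0)).Local v)), IsOpen U ∧ t₀ ∈ U ∧
          ∃ A₀ : Set (((UnitaryGroup.cmDatum L 2 (Matrix.of fun i j : Fin 2 => if i.val + j.val + 1 = 2 then (1 : L) else 0)).Local v × (UnitaryGroup.cmDatum L 1 (Matrix.of fun i j : Fin 1 => if i.val + j.val + 1 = 1 then (1 : L) else 0)).Local v) ⧸ (T : Subgroup ((UnitaryGroup.cmDatum L 2 (Matrix.of fun i j : Fin 2 => if i.val + j.val + 1 = 2 then (1 : L) else 0)).Local v × (UnitaryGroup.cmDatum L 1 (Matrix.of fun i j : Fin 1 => if i.val + j.val + 1 = 1 then (1 : L) else 0)).Local v))), MeasurableSet A₀ ∧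
            (quotientMeasure (T : Subgroup ((UnitaryGroup.cmDatum L 2 (Matrix.of fun i j : Fin 2 => if i.val + j.val + 1 = 2 then (1 : L) else 0)).Local v × (UnitaryGroup.cmDatum L 1 (Matrix.of fun i j : Fin 1 => if i.val + j.val + 1 = 1 then (1 : L) else 0)).Local v)) (tT T) (isClosed_of_exists_eq_centralizerH (hS T T.2)) νHv) A₀ ≠ 0 ∧
            (quotientMeasure (T : Subgroup ((UnitaryGroup.cmDatum L 2 (Matrix.of fun i j : Fin 2 => if i.val + j.val + 1 = 2 then (1 : L) else 0)).Local v × (UnitaryGroup.cmDatum L 1 (Matrix.of fun i j : Fin 1 => if i.val + j.val + 1 = 1 then (1 : L) else 0)).Local v)) (tT T) (isClosed_of_exists_eq_centralizerH (hS T T.2)) νHv) A₀ ≠ ∞ ∧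
            ∀ V : Set ↥(T : Subgroup ((UnitaryGroup.cmDatum L 2 (Matrix.of fun i j : Fin 2 => if i.val + j.val + 1 = 2 then (1 : L) else 0)).Local v × (UnitaryGroup.cmDatum L 1 (Matrix.of fun i j : Fin 1 => if i.val + j.val + 1 = 1 then (1 : L) else 0)).Local v)), MeasurableSet V → V ⊆ U → (∀ t ∈ V, IsLocalGRegular L v (t : ((UnitaryGroup.cmDatum L 2 (Matrix.of fun i j : Fin 2 => if i.val + j.val + 1 = 2 then (1 : L) else 0)).Local v × (UnitaryGroup.cmDatum L 1 (Matrix.of fun i j : Fin 1 => if i.val + j.val + 1 = 1 then (1 : L) else 0)).Local v))) →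
              (∀ n : ((UnitaryGroup.cmDatum L 2 (Matrix.of fun i j : Fin 2 => if i.val + j.val + 1 = 2 then (1 : L) else 0)).Local v × (UnitaryGroup.cmDatum L 1 (Matrix.of fun i j : Fin 1 => if i.val + j.val + 1 = 1 then (1 : L) else 0)).Local v), n ∉ (T : Subgroup ((UnitaryGroup.cmDatum L 2 (Matrix.of fun i j : Fin 2 => if i.val + j.val + 1 = 2 then (1 : L) else 0)).Local v × (UnitaryGroup.cmDatum L 1 (Matrix.of fun i j : Fin 1 => if i.val + j.val + 1 = 1 then (1 : L) else 0)).Local v)) → ∀ t ∈ V, ∀ t' ∈ V, ((t' : ↥(T : Subgroup ((UnitaryGroup.cmDatum L 2 (Matrix.of fun i j : Fin 2 => if i.val + j.val + 1 = 2 then (1 : L) else 0)).Local v × (UnitaryGroup.cmDatum L 1 (Matrix.of fun i j : Fin 1 => if i.val + j.val + 1 = 1 then (1 : L) else 0)).Local v))) : ((UnitaryGroup.cmDatum L 2 (Matrix.of fun i j : Fin 2 => if i.val + j.val + 1 = 2 then (1 : L) else 0)).Local v × (UnitaryGroup.cmDatum L 1 (Matrix.of fun i j : Fin 1 => if i.val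 + j.val + 1 = 1 then (1 : L) else 0)).Local v)) ≠ n * t * n⁻¹) →
                νHv {y : ((UnitaryGroup.cmDatum L 2 (Matrix.of fun i j : Fin 2 => if i.val + j.val + 1 = 2 then (1 : L) else 0)).Local v × (UnitaryGroup.cmDatum L 1 (Matrix.of fun i j : Fin 1 => if i.val + j.val + 1 = 1 then (1 : L) else 0)).Local v) | ∃ (x : ((UnitaryGroup.cmDatum L 2 (Matrix.of fun i j : Fin 2 => if i.val + j.val + 1 = 2 then (1 : L) else 0)).Local v × (UnitaryGroup.cmDatum L 1 (Matrix.of fun i j : Fin 1 => if i.val + j.val + 1 = 1 then (1 : L) else 0)).Local v)) (t : ↥(T : Subgroup ((UnitaryGroup.cmDatum L 2 (Matrix.of fun i j : Fin 2 => if i.val + j.val + 1 = 2 then (1 : L) else 0)).Local v × (UnitaryGroup.cmDatum L 1 (Matrix.of fun i j : Fin 1 => if i.val + j.val + 1 = 1 then (1 : L) else 0)).Local v))), (QuotientGroup.mk x : ((UnitaryGroup.cmDatum L 2 (Matrix.of fun i j : Fin 2 => if i.val + j.val + 1 = 2 then (1 : L) else 0)).Local v × (UnitaryGroup.cmDatum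 L 1 (Matrix.of fun i j : Fin 1 => if i.val + j.val + 1 = 1 then (1 : L) else 0)).Local v) ⧸ (T : Subgroup ((UnitaryGroup.cmDatum L 2 (Matrix.of fun i j : Fin 2 => if i.val + j.val + 1 = 2 then (1 : L) else 0)).Local v × (UnitaryGroup.cmDatum L 1 (Matrix.of fun i j : Fin 1 => if i.val + j.val + 1 = 1 then (1 : L) else 0)).Local v))) ∈ A₀ ∧ t ∈ V ∧ y = x * t * x⁻¹} =
                  (quotientMeasure (T : Subgroup ((UnitaryGroup.cmDatum L 2 (Matrix.of fun i j : Fin 2 => if i.val + j.val + 1 = 2 then (1 : L) else 0)).Local v × (UnitaryGroup.cmDatum L 1 (Matrix.of fun i j : Fin 1 => if i.val + j.val + 1 = 1 then (1 : L) else 0)).Local v)) (tT T) (isClosed_of_exists_eq_centralizerH (hS T T.2)) νHv) A₀ *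
                    ∫⁻ t in V, ((NNReal.sqrt ((∏ w : PlacesOver L v, Literature.NumberTheory.GaloisRepresentations.IsNonarchimedeanLocalField.normAbs (w.1.adicCompletion L) (((((t : ((UnitaryGroup.cmDatum L 2 (Matrix.of fun i j : Fin 2 => if i.val + j.val + 1 = 2 then (1 : L) else 0)).Local v × (UnitaryGroup.cmDatum L 1 (Matrix.of fun i j : Fin 1 => if i.val + j.val + 1 = 1 then (1 : L) else 0)).Local v)).1.val : GL (Fin 2) (UnitaryGroup.LocalRing L v))).val.charpoly.discr) w)) * (∏ w : PlacesOver L v, Literature.NumberTheory.GaloisRepresentations.IsNonarchimedeanLocalField.normAbs (w.1.adicCompletion L) (((((t : ((UnitaryGroup.cmDatum L 2 (Matrix.of fun i j : Fin 2 => if i.val + j.val + 1 = 2 then (1 : L) else 0)).Local v × (UnitaryGroup.cmDatum L 1 (Matrix.of fun i j : Fin 1 => if i.val + j.val + 1 = 1 then (1 : L) else 0)).Local v)).1.val : GL (Fin 2) (UnitaryGroup.LocalRing L v))).val.det) w))⁻¹) : ℝ≥0) : ℝ≥0∞) ∂(tT T) := by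
  intro T hc
  have hTM : (T : Subgroup ((UnitaryGroup.cmDatum L 2 (Matrix.of fun i j : Fin 2 => if i.val + j.val + 1 = 2 then (1 : L) else 0)).Local v × (UnitaryGroup.cmDatum L 1 (Matrix.of fun i j : Fin 1 => if i.val + j.val + 1 = 1 then (1 : L) else 0)).Local v)) = ((cmBorelTriple L 2 v).M).prod ⊤ := by
    by_contra h
    exact hc (hcpt T T.2 h)
  letI : MeasurableSpace (((UnitaryGroup.cmDatum L 2 (Matrix.of fun i j : Fin 2 => if i.val + j.val + 1 = 2 then (1 : L) else 0)).Local v × (UnitaryGroup.cmDatum L 1 (Matrix.of fun i j : Fin 1 => if i.val + j.val + 1 = 1 then (1 : L) else 0)).Local v) ⧸ (T : Subgroup ((UnitaryGroup.cmDatum L 2 (Matrix.of fun i j : Fin 2 => if i.val + j.val + 1 = 2 then (1 : L) else 0)).Local v × (UnitaryGroup.cmDatum L 1 (Matrix.of fun i j : Fin 1 => if i.val + j.val + 1 = 1 then (1 : L) else 0)).Local v))) := borel _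
  haveI : BorelSpace (((UnitaryGroup.cmDatum L 2 (Matrix.of fun i j : Fin 2 => if i.val + j.val + 1 = 2 then (1 : L) else 0)).Local v × (UnitaryGroup.cmDatum L 1 (Matrix.of fun i j : Fin 1 => if i.val + j.val + 1 = 1 then (1 : L) else 0)).Local v) ⧸ (T : Subgroup ((UnitaryGroup.cmDatum L 2 (Matrix.of fun i j : Fin 2 => if i.val + j.val + 1 = 2 then (1 : L) else 0)).Local v × (UnitaryGroup.cmDatum L 1 (Matrix.of fun i j : Fin 1 => if i.val + j.val + 1 = 1 then (1 : L) else 0)).Local v))) := ⟨rfl⟩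
  have hsock := F0P3cStCharTSUpTrJacCartanSplitH.tubeJacobianLocal_splitCartanH_of_dock L v hns
    (F0P3cStCharTSUpTrJacSplitModelTwo.tubeJacobianLocal_splitCartan_U2 L v hns) νHv hTM
    (isClosed_of_exists_eq_centralizerH (hS T T.2)) (Φ T) (hΦ T) (tT T) (htT T) (fun t => NNReal.sqrt ((∏ w : PlacesOver L v, Literature.NumberTheory.GaloisRepresentations.IsNonarchimedeanLocalField.normAbs (w.1.adicCompletion L) (((((t : ((UnitaryGroup.cmDatum L 2 (Matrix.of fun i j : Fin 2 => if i.val + j.val + 1 = 2 then (1 : L) else 0)).Local v × (UnitaryGroup.cmDatum L 1 (Matrix.of fun i j : Fin 1 => if i.val + j.val + 1 = 1 then (1 : L) else 0)).Local v)).1.val : GL (Fin 2) (UnitaryGroup.LocalRing L v))).val.charpoly.discr) w)) * (∏ w : PlacesOver L v, Literature.NumberTheory.GaloisRepresentations.IsNonarchimedeanLocalField.normAbs (w.1.adicCompletion L) (((((t : ((UnitaryGroup.cmDatum L 2 (Matrix.of fun i j : Fin 2 => if i.val + j.val + 1 = 2 then (1 : L) else 0)).Local v × (UnitaryGroup.cmDatum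 L 1 (Matrix.of fun i j : Fin 1 => if i.val + j.val + 1 = 1 then (1 : L) else 0)).Local v)).1.val : GL (Fin 2) (UnitaryGroup.LocalRing L v))).val.det) w))⁻¹))
    (fun t => by rw [← NNReal.coe_pow, NNReal.sq_sqrt])
  intro t₀ ht₀
  obtain ⟨U, hUo, ht₀U, A₀, hA₀m, hA₀0, hA₀top, hV⟩ := hsock t₀ ht₀
  refine ⟨U, hUo, ht₀U, A₀, hA₀m, hA₀0, hA₀top, fun V hVm hVU hVreg hVW => ?_⟩
  rw [← image_conjFamily_prod_eq (Φ T) (hΦ T)]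
  exact hV V hVm hVU hVreg hVW

/-! ## §2 How consumers read the unconditional Weyl integration formula on `H_v`

The four currencies with NO tube-Jacobian hypothesis are ONE-LINE compositions of ★ (H5″) with §1 (the gate's dedup rule forbids restating ★ (H5″)'s conclusions under the
discharged hypothesis, so they are not re-declared here):
* `ℝ≥0∞`:   `lintegral_eq_finsetSum_weighted_orbital_H_of_splitSocket hns νHv SHall hS hcov hnc Φ hΦ tT htT (hJacNC_of_splitDock hns νHv SHall hS hcpt Φ hΦ tT htT) f hf`
* Bochner: `integral_eq_finsetSum_weighted_orbital_H_of_splitSocket hns νHv SHall hS hcov hnc Φ hΦ tT htT (hJacNC_of_splitDock hns νHv SHall hS hcpt Φ hΦ tT htT) g hg`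
* (A):     `integral_mul_classFun_eq_finsetSum_weighted_classOrbitalIntegral_H_of_splitSocket hns νHv SHall hS hcov hnc Φ hΦ tT htT (hJacNC_of_splitDock …) hcanH fH α hf hα hfα`
* `D_H`:   `integral_mul_classFun_eq_finsetSum_DH_classOrbitalIntegral_H_of_splitSocket hns νHv SHall hS hcov hnc Φ hΦ tT htT (hJacNC_of_splitDock …) hcanH dh hdh fH α hf hα hfα`
with `SHall hS hcpt hcov hnc` from ★ (H1) `F0P3cStCharTSCartanAllH.exists_cartanAllH_weylShape L v hns` (clauses 2–5), `tT ∕ htT` from ★ (H3d) `exists_haar_cartanH_compactCore_eq_one`,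
`Φ ∕ hΦ` from ★ `exists_conjFamily`, `hcanH` and `hdh` the block's pins. -/

end Family

end Summit.HodgeConjecture.HodgeConjecture.Cruxes.H413.F0P3cStCharTSUpTrWIFHFull

end
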